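import Mathlib.MeasureTheory.Integral.IntervalIntegral.Basic
import Mathlib.Analysis.Normed.Group.Bounded
import Mathlib.Topology.UniformSpace.HeineCantor
import Mathlib.Algebra.Order.Floor.Ring
import HarnessLib

/-!
# From box statistics to continuous test functions (a Riemann-sum lemma, proved)

Trunk T-ANT (`Literature/NumberTheory/LFunctions`). Proofs only: no definitions, no named facts,
nothing about `ζ`. The standard approximation step in the equivalence between Montgomery's pair
correlation conjecture and the `2`-level GUE hypothesis (`ZeroStatistics.lean`,
`gueHypothesisAt_one_iff_montgomery`): if a family of finite configurations of reals `d i k`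
(`k ∈ S i`), normalised by `n i > 0`, has box statistics
`#{k : d i k ∈ [α, β]} / n i → ∫_α^β w` for every `α < β`, with a continuous weight
`0 ≤ w ≤ 1`, then `(∑_k φ(d i k)) / n i → ∫ φ w` for every continuous compactly supported
`φ` (`PairCount.tendsto_sum_div_of_tendsto_card_Icc_div`). Proof: half-open boxes `(x_j, x_{j+1}]`
are differences of closed boxes, they partition a neighbourhood of the support of `φ`, and on
each of them `φ` oscillates by less than `ε` (uniform continuity); the Riemann sums of `φ w`
converge likewise.

## References

* H. L. Montgomery, *The pair correlation of zeros of the zeta function*, Proc. Sympos. Pure Math.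
  24 (1973), 181–193, §1 (the passage from (12) to test functions).
* Z. Rudnick, P. Sarnak, Duke Math. J. 81 (1996), §1 Remark 1.
-/

noncomputable section

open Finset MeasureTheory Filter Topology

namespace Literature.NumberTheory.LFunctions

namespace PairCount

/-! ## Half-open boxes partitioning an interval -/

/-- A point of `(x₀, x₀ + L η]` lies in one of the boxes `(x₀ + j η, x₀ + (j+1) η]`, `j < L`. [folklore] -/
theorem exists_mem_Ioc_box {x₀ η : ℝ} (hη : 0 < η) {L : ℕ} {y : ℝ}
    (hy : y ∈ Set.Ioc x₀ (x₀ + L * η)) :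
    ∃ j < L, y ∈ Set.Ioc (x₀ + j * η) (x₀ + (j + 1 : ℕ) * η) := by
  obtain ⟨hy1, hy2⟩ := hy
  set m : ℤ := ⌈(y - x₀) / η⌉ with hm
  have hm1 : 1 ≤ m := by
    rw [hm, Int.one_le_ceil_iff]
    exact div_pos (by linarith) hη
  have hmL : m ≤ L := by
    rw [hm, Int.ceil_le, div_le_iff₀ hη]
    push_cast
    linarith
  have hceil := (Int.ceil_eq_iff (z := m)).1 rfl
  have hc1 : ((m : ℝ) - 1) * η < y - x₀ := (lt_div_iff₀ hη).1 hceil.1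
  have hc2 : y - x₀ ≤ (m : ℝ) * η := (div_le_iff₀ hη).1 hceil.2
  refine ⟨(m - 1).toNat, ?_, ?_⟩
  · omega
  · have hcast : (((m - 1).toNat : ℕ) : ℝ) = (m : ℝ) - 1 := by
      have : (((m - 1).toNat : ℕ) : ℤ) = m - 1 := Int.toNat_of_nonneg (by omega)
      exact_mod_cast this
    constructor
    · rw [hcast]; linarith
    · push_cast
      rw [hcast]; linarith

/-- Distinct boxes `(x₀ + j η, x₀ + (j+1) η]` are disjoint. [folklore] -/
theorem disjoint_filter_Ioc_box {κ : Type*} (S : Finset κ) (d : κ → ℝ) {x₀ η : ℝ} (hη : 0 < η)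
    {j j' : ℕ} (hjj' : j ≠ j') :
    Disjoint (S.filter fun k ↦ d k ∈ Set.Ioc (x₀ + j * η) (x₀ + (j + 1 : ℕ) * η))
      (S.filter fun k ↦ d k ∈ Set.Ioc (x₀ + j' * η) (x₀ + (j' + 1 : ℕ) * η)) := by
  rw [disjoint_filter]
  intro k _ h1 h2
  obtain ⟨h1a, h1b⟩ := h1
  obtain ⟨h2a, h2b⟩ := h2
  push_cast at h1b h2b
  rcases lt_or_gt_of_ne hjj' with h | h
  · have : (j : ℝ) + 1 ≤ j' := by exact_mod_cast h
    nlinarith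
  · have : (j' : ℝ) + 1 ≤ j := by exact_mod_cast h
    nlinarith

/-! ## The Riemann-sum lemma -/

/-- **From boxes to continuous compactly supported test functions.** Let `d i k` (`k ∈ S i`) be
finite configurations of reals indexed by `i`, normalised by `n i > 0` (eventually along `l`),
and let `0 ≤ w ≤ 1` be a continuous weight. If
`#{k ∈ S i : d i k ∈ [α, β]} / n i → ∫_α^β w` along `l` for every `α < β`, then for every
continuous compactly supported `φ : ℝ → ℝ`,
`(∑_{k ∈ S i} φ (d i k)) / n i → ∫ φ w` along `l`. (The approximation step "from (12) to test
functions" of Montgomery 1973, §1; Riemann sums over half-open boxes, which are differences of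
closed boxes, and uniform continuity of `φ`.) [folklore] -/
theorem tendsto_sum_div_of_tendsto_card_Icc_div {ι κ : Type*} {l : Filter ι}
    (S : ι → Finset κ) (d : ι → κ → ℝ) (n : ι → ℝ) (hn : ∀ᶠ i in l, 0 < n i)
    {w : ℝ → ℝ} (hw : Continuous w) (hw0 : ∀ x, 0 ≤ w x) (hw1 : ∀ x, w x ≤ 1)
    (hbox : ∀ α β : ℝ, α < β →
      Tendsto (fun i ↦ (((S i).filter fun k ↦ d i k ∈ Set.Icc α β).card : ℝ) / n i) l
        (𝓝 (∫ x in α..β, w x)))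
    {φ : ℝ → ℝ} (hφ : Continuous φ) (hφs : HasCompactSupport φ) :
    Tendsto (fun i ↦ (∑ k ∈ S i, φ (d i k)) / n i) l (𝓝 (∫ x, φ x * w x)) := by
  classical
  -- support of `φ` inside `[-B, B]`
  obtain ⟨r, hr⟩ := hφs.isCompact.isBounded.subset_closedBall 0
  set B : ℝ := max r 1 with hB
  have hB1 : 1 ≤ B := le_max_right _ _
  have hsupp : ∀ x, φ x ≠ 0 → x ∈ Set.Icc (-B) B := by
    intro x hx
    have hx' : x ∈ Metric.closedBall (0 : ℝ) r := hr (subset_tsupport _ hx)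
    rw [Metric.mem_closedBall, Real.dist_eq, sub_zero, abs_le] at hx'
    constructor <;> linarith [le_max_left r 1, hx'.1, hx'.2]
  -- uniform continuity
  have huc : UniformContinuous φ := hφs.uniformContinuous_of_continuous hφ
  rw [Metric.tendsto_nhds]
  intro ε hε
  set ε' : ℝ := ε / (4 * B + 8) with hε'
  have hε'0 : 0 < ε' := by positivity
  obtain ⟨δ, hδ, hδφ⟩ := Metric.uniformContinuous_iff.1 huc ε' hε'0
  -- the grid
  obtain ⟨L, hL⟩ := exists_nat_gt ((2 * B + 2) / δ)
  have hL0 : (0 : ℝ) < L := lt_trans (by positivity) hL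
  have hLpos : 0 < L := by exact_mod_cast hL0
  set η : ℝ := (2 * B + 2) / L with hη
  have hη0 : 0 < η := by positivity
  have hηδ : η < δ := by
    rw [hη, div_lt_iff₀ hL0]
    rw [div_lt_iff₀ hδ] at hL
    linarith
  set x : ℕ → ℝ := fun j ↦ -(B + 1) + j * η with hx
  have hx0 : x 0 = -(B + 1) := by simp [hx]
  have hxL : x L = B + 1 := by
    simp only [hx, hη]
    field_simp
    ring
  have hxsucc : ∀ j : ℕ, x (j + 1) = x j + η := by
    intro j; simp only [hx]; push_cast; ring
  have hxmono : ∀ j : ℕ, x j < x (j + 1) := fun j ↦ by rw [hxsucc]; linarith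
  set a₀ : ℝ := -(B + 2) with ha₀
  have ha₀x : ∀ j : ℕ, a₀ < x j := by
    intro j
    simp only [hx, ha₀]
    have : (0 : ℝ) ≤ j * η := by positivity
    linarith
  -- boxes as filters
  obtain ⟨box, hboxdef⟩ : ∃ box : ι → ℕ → Finset κ, box = fun i j ↦
      (S i).filter fun k ↦ d i k ∈ Set.Ioc (x j) (x (j + 1)) := ⟨_, rfl⟩
  obtain ⟨cl, hcldef⟩ : ∃ cl : ι → ℝ → ℝ → Finset κ, cl = fun i α β ↦
      (S i).filter fun k ↦ d i k ∈ Set.Icc α β := ⟨_, rfl⟩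
  have hmem_box : ∀ i j k, k ∈ box i j ↔ k ∈ S i ∧ x j < d i k ∧ d i k ≤ x (j + 1) := by
    intro i j k
    rw [hboxdef, mem_filter, Set.mem_Ioc]
  have hmem_cl : ∀ i α β k, k ∈ cl i α β ↔ k ∈ S i ∧ α ≤ d i k ∧ d i k ≤ β := by
    intro i α β k
    rw [hcldef, mem_filter, Set.mem_Icc]
  -- (1) box counts are differences of closed-box counts, hence converge
  have hbox_eq : ∀ i j, ((box i j).card : ℝ) =
      ((cl i a₀ (x (j + 1))).card : ℝ) - (cl i a₀ (x j)).card := by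
    intro i j
    have hsub : cl i a₀ (x j) ⊆ cl i a₀ (x (j + 1)) := by
      intro k hk
      rw [hmem_cl] at hk ⊢
      exact ⟨hk.1, hk.2.1, hk.2.2.trans (hxmono j).le⟩
    have hsd : cl i a₀ (x (j + 1)) \ cl i a₀ (x j) = box i j := by
      ext k
      rw [Finset.mem_sdiff, hmem_cl, hmem_cl, hmem_box]
      constructor
      · rintro ⟨⟨hk, h1, h2⟩, h3⟩
        refine ⟨hk, ?_, h2⟩
        by_contra hle
        exact h3 ⟨hk, h1, not_lt.1 hle⟩
      · rintro ⟨hk, h1, h2⟩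
        exact ⟨⟨hk, (ha₀x j).le.trans h1.le, h2⟩, fun h ↦ absurd h.2.2 (not_le.2 h1)⟩
    rw [← hsd, card_sdiff_of_subset hsub, Nat.cast_sub (card_le_card hsub)]
  have hbox_tendsto : ∀ j, Tendsto (fun i ↦ ((box i j).card : ℝ) / n i) l
      (𝓝 (∫ t in x j..x (j + 1), w t)) := by
    intro j
    have h1 := hbox a₀ (x (j + 1)) (ha₀x (j + 1))
    have h2 := hbox a₀ (x j) (ha₀x j)
    have h3 := h1.sub h2
    rw [intervalIntegral.integral_interval_sub_left (hw.intervalIntegrable _ _)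
      (hw.intervalIntegrable _ _)] at h3
    refine h3.congr fun i ↦ ?_
    simp only [hbox_eq, sub_div, hcldef]
  -- (2) the decomposition of the sum over the boxes
  have hdisj : ∀ i, Set.PairwiseDisjoint (↑(range L) : Set ℕ) (box i) := by
    intro i j _ j' _ hjj'
    have := disjoint_filter_Ioc_box (S i) (d i) (x₀ := -(B + 1)) hη0 hjj'
    rw [hboxdef]
    exact this
  have hmono' : Monotone x := monotone_nat_of_le_succ fun m ↦ (hxmono m).le
  have hunion_sub : ∀ i, (range L).biUnion (box i) ⊆ cl i a₀ (x L) := by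
    intro i k hk
    rw [mem_biUnion] at hk
    obtain ⟨j, hj, hk⟩ := hk
    rw [mem_range] at hj
    rw [hmem_box] at hk
    obtain ⟨hkS, h1, h2⟩ := hk
    rw [hmem_cl]
    exact ⟨hkS, (ha₀x j).le.trans h1.le, h2.trans (hmono' hj)⟩
  have hdecomp : ∀ i, ∑ k ∈ S i, φ (d i k) = ∑ j ∈ range L, ∑ k ∈ box i j, φ (d i k) := by
    intro i
    rw [← sum_biUnion (hdisj i)]
    symm
    refine sum_subset (fun k hk ↦ ?_) (fun k hkS hk ↦ ?_)
    · exact ((hmem_cl _ _ _ _).1 (hunion_sub i hk)).1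
    · by_contra hne
      have hkB := hsupp _ hne
      have hkI : d i k ∈ Set.Ioc (-(B + 1)) (-(B + 1) + L * η) := by
        have : -(B + 1) + L * η = B + 1 := hxL
        rw [this]
        exact ⟨by linarith [hkB.1], by linarith [hkB.2]⟩
      obtain ⟨j, hjL, hj⟩ := exists_mem_Ioc_box hη0 hkI
      apply hk
      rw [mem_biUnion]
      refine ⟨j, mem_range.2 hjL, ?_⟩
      rw [hmem_box]
      exact ⟨hkS, hj.1, hj.2⟩
  -- (3) oscillation on each box
  have hosc : ∀ i j, ∀ k ∈ box i j, |φ (d i k) - φ (x j)| ≤ ε' := by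
    intro i j k hk
    rw [hmem_box] at hk
    have hdist : dist (d i k) (x j) < δ := by
      rw [Real.dist_eq, abs_of_pos (by linarith [hk.2.1])]
      rw [hxsucc] at hk
      linarith [hk.2.2]
    have := hδφ hdist
    rw [Real.dist_eq] at this
    exact this.le
  have hboxsum : ∀ i j, |∑ k ∈ box i j, φ (d i k) - (box i j).card * φ (x j)| ≤
      ε' * (box i j).card := by
    intro i j
    have : ∑ k ∈ box i j, φ (d i k) - (box i j).card * φ (x j) =
        ∑ k ∈ box i j, (φ (d i k) - φ (x j)) := by
      rw [sum_sub_distrib, sum_const, nsmul_eq_mul]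
    rw [this]
    calc |∑ k ∈ box i j, (φ (d i k) - φ (x j))| ≤ ∑ k ∈ box i j, |φ (d i k) - φ (x j)| :=
          abs_sum_le_sum_abs _ _
      _ ≤ ∑ k ∈ box i j, ε' := sum_le_sum (hosc i j)
      _ = ε' * (box i j).card := by rw [sum_const, nsmul_eq_mul, mul_comm]
  have hmain : ∀ i, |∑ k ∈ S i, φ (d i k) - ∑ j ∈ range L, (box i j).card * φ (x j)| ≤
      ε' * (cl i a₀ (x L)).card := by
    intro i
    rw [hdecomp i, ← sum_sub_distrib]
    calc |∑ j ∈ range L, (∑ k ∈ box i j, φ (d i k) - (box i j).card * φ (x j))|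
        ≤ ∑ j ∈ range L, |∑ k ∈ box i j, φ (d i k) - (box i j).card * φ (x j)| :=
          abs_sum_le_sum_abs _ _
      _ ≤ ∑ j ∈ range L, ε' * (box i j).card := sum_le_sum fun j _ ↦ hboxsum i j
      _ = ε' * ((range L).biUnion (box i)).card := by
          rw [card_biUnion (hdisj i), ← mul_sum]
          push_cast
          rfl
      _ ≤ ε' * (cl i a₀ (x L)).card := by
          gcongr
          exact hunion_sub i
  -- (4) the Riemann sum is close to the integral
  set R : ℝ := ∑ j ∈ range L, φ (x j) * ∫ t in x j..x (j + 1), w t with hR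
  have hφw_int : ∀ u v, IntervalIntegrable (fun t ↦ φ t * w t) volume u v :=
    fun u v ↦ (hφ.mul hw).intervalIntegrable u v
  have hint_eq : ∫ t, φ t * w t = ∫ t in x 0..x L, φ t * w t := by
    rw [intervalIntegral.integral_of_le (by rw [hx0, hxL]; linarith)]
    symm
    refine setIntegral_eq_integral_of_forall_compl_eq_zero fun t ht ↦ ?_
    by_contra hne
    have hφne : φ t ≠ 0 := fun h0 ↦ hne (by rw [h0, zero_mul])
    have htB := hsupp t hφne
    apply ht
    rw [hx0, hxL]
    exact ⟨by linarith [htB.1], by linarith [htB.2]⟩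
  have hRiemann : |R - ∫ t, φ t * w t| ≤ ε' * (2 * B + 2) := by
    rw [hint_eq, ← intervalIntegral.sum_integral_adjacent_intervals fun j _ ↦ hφw_int _ _, hR,
      ← sum_sub_distrib]
    have hterm : ∀ j ∈ range L,
        |φ (x j) * (∫ t in x j..x (j + 1), w t) - ∫ t in x j..x (j + 1), φ t * w t| ≤ ε' * η := by
      intro j _
      rw [← intervalIntegral.integral_const_mul,
        ← intervalIntegral.integral_sub ((hw.intervalIntegrable _ _).const_mul _) (hφw_int _ _)]
      have hbound : ∀ t ∈ Set.uIoc (x j) (x (j + 1)), ‖φ (x j) * w t - φ t * w t‖ ≤ ε' := by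
        intro t ht
        rw [Set.uIoc_of_le (hxmono j).le] at ht
        rw [← sub_mul, norm_mul, Real.norm_eq_abs, Real.norm_eq_abs, abs_of_nonneg (hw0 t)]
        have h1 : |φ (x j) - φ t| ≤ ε' := by
          rw [abs_sub_comm]
          have hdist : dist t (x j) < δ := by
            rw [Real.dist_eq, abs_of_pos (by linarith [ht.1])]
            rw [hxsucc] at ht
            linarith [ht.2]
          have := hδφ hdist
          rw [Real.dist_eq] at this
          exact this.le
        calc |φ (x j) - φ t| * w t ≤ ε' * 1 :=
              mul_le_mul h1 (hw1 t) (hw0 t) hε'0.le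
          _ = ε' := mul_one _
      have := intervalIntegral.norm_integral_le_of_norm_le_const hbound
      have hlen : |x (j + 1) - x j| = η := by
        rw [hxsucc, add_sub_cancel_left, abs_of_pos hη0]
      rw [Real.norm_eq_abs, hlen] at this
      exact this
    calc |∑ j ∈ range L, (φ (x j) * (∫ t in x j..x (j + 1), w t) - ∫ t in x j..x (j + 1), φ t * w t)|
        ≤ ∑ j ∈ range L, |φ (x j) * (∫ t in x j..x (j + 1), w t) - ∫ t in x j..x (j + 1), φ t * w t| :=
          abs_sum_le_sum_abs _ _
      _ ≤ ∑ j ∈ range L, ε' * η := sum_le_sum hterm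
      _ = ε' * (2 * B + 2) := by
          rw [sum_const, card_range, nsmul_eq_mul, hη]
          field_simp
  -- (5) limits of the finitely many box statistics
  have hF : Tendsto (fun i ↦ ∑ j ∈ range L, ((box i j).card : ℝ) / n i * φ (x j)) l (𝓝 R) := by
    rw [hR]
    refine tendsto_finsetSum _ fun j _ ↦ ?_
    have := (hbox_tendsto j).mul_const (φ (x j))
    refine this.congr' (Eventually.of_forall fun i ↦ rfl) |>.trans ?_
    rw [mul_comm]
  have hG : Tendsto (fun i ↦ ((cl i a₀ (x L)).card : ℝ) / n i) l (𝓝 (∫ t in a₀..x L, w t)) := by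
    rw [hcldef]
    exact hbox a₀ (x L) (ha₀x L)
  have hGbound : ∫ t in a₀..x L, w t ≤ 2 * B + 3 := by
    have hle : a₀ ≤ x L := (ha₀x L).le
    have := intervalIntegral.integral_mono_on hle (hw.intervalIntegrable (μ := volume) _ _)
      intervalIntegrable_const (fun t _ ↦ hw1 t)
    simp only [intervalIntegral.integral_const, smul_eq_mul, mul_one] at this
    rw [hxL, ha₀] at this ⊢
    linarith
  -- (6) assemble
  have hF' := (Metric.tendsto_nhds.1 hF) ε' hε'0
  have hG' := (tendsto_order.1 hG).2 (2 * B + 4) (by linarith)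
  filter_upwards [hn, hF', hG'] with i hni hFi hGi
  rw [Real.dist_eq] at hFi ⊢
  have hm := hmain i
  -- divide the main estimate by `n i`
  have hm' : |(∑ k ∈ S i, φ (d i k)) / n i -
      ∑ j ∈ range L, ((box i j).card : ℝ) / n i * φ (x j)| ≤
        ε' * (((cl i a₀ (x L)).card : ℝ) / n i) := by
    have hsum : ∑ j ∈ range L, ((box i j).card : ℝ) / n i * φ (x j) =
        (∑ j ∈ range L, ((box i j).card : ℝ) * φ (x j)) / n i := by
      rw [Finset.sum_div]
      exact Finset.sum_congr rfl fun j _ ↦ by ring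
    rw [hsum, ← sub_div, abs_div, abs_of_pos hni, div_le_iff₀ hni]
    calc |∑ k ∈ S i, φ (d i k) - ∑ j ∈ range L, ↑(box i j).card * φ (x j)|
        ≤ ε' * (cl i a₀ (x L)).card := hm
      _ = ε' * (((cl i a₀ (x L)).card : ℝ) / n i) * n i := by
          field_simp
  have hcl0 : 0 ≤ ((cl i a₀ (x L)).card : ℝ) / n i := by positivity
  have h1 : |(∑ k ∈ S i, φ (d i k)) / n i - R| ≤ ε' * (2 * B + 4) + ε' := by
    have := abs_sub_le ((∑ k ∈ S i, φ (d i k)) / n i)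
      (∑ j ∈ range L, ((box i j).card : ℝ) / n i * φ (x j)) R
    have h2 : ε' * (((cl i a₀ (x L)).card : ℝ) / n i) ≤ ε' * (2 * B + 4) :=
      mul_le_mul_of_nonneg_left hGi.le hε'0.le
    linarith [hFi.le]
  have h3 := abs_sub_le ((∑ k ∈ S i, φ (d i k)) / n i) R (∫ t, φ t * w t)
  have hε'B : ε' * (4 * B + 7) < ε := by
    rw [hε', div_mul_eq_mul_div, div_lt_iff₀ (by positivity)]
    nlinarith
  linarith [hRiemann]

end PairCount

end Literature.NumberTheory.LFunctions

end
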